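/-
Copyright (c) 2026 the pub-hodgecm-mathlib formalisation cell (harness21).  Prover seat hodgecm-mathlib-F0P2-p11 (g4), routed by chair K2-lead (g2) VALVE 22 (z) to R90-TF section S8
«ContSpec-n½» (dealer R90-CS-plan (g3), S8-R238 (2) 2026-09-05T02:52Z): `K2E1ChiScatteringOperatorFactorisationCMThree` — J-S8-FN GLOBAL-ANALYTIC half, the OPERATOR form of
K2E2-p12 (g10)'s Euler head «`Q_j = cS·a_j`, `a_j` holomorphic on `{1 < Re}`» on a block of sections: `M(z) = cS(z)•A(z)`, `M₋₁ = (Res cS)•A(z₀)`.  Consumer: K2E1-p10 (g6) RES-INT line 7.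
-/
import Summits.HodgeConjecture.HodgeConjecture.Theorems.R90S8ResGMidAtomArchStableU3   -- ★ (K2E1-p11): `R90.S8.eqOn_reSlit_of_eqOn_re_gt` (identity theorem on the slit half-plane `{a < Re} ∖ S`, `S ⊆ ℝ`)
import HarnessLib

/-!
# K2·E1 ∕ R90·S8 — `K2E1ChiScatteringOperatorFactorisationCMThree`: THE INTERTWINING COORDINATES AS AN OPERATOR `M(z) = cS(z)•A(z)` ON A BLOCK, AND `M₋₁ = (Res_{z₀} cS)•A(z₀)`

Cell `pub/hodgecm-mathlib`, crux h413 = `stmt-HodgeConjecture-24833`, route of record `HCCMUnconditional`; R90-TF section S8 «ContSpec-n½», RES-INT road (M-a) line 7 ∕ FACT-N GLOBAL-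
ANALYTIC half (dealer R90-CS-plan (g3) S8-R238 (2); consumer K2E1-p10 (g6)).  THEOREMS ONLY (no `def`, no `instance`, no notation, no named-fact hypothesis, no `sorry`; default
heartbeats); lane `--supports stmt-HodgeConjecture-24833 --as helper` (count-neutral).  Closes no socket.

THE MATHEMATICS ([MoeglinWaldspurger1995] IV.1.9–IV.1.11; [Langlands1976] §7; [Conway1978] IV §3).  CURRENCY (★ p864700 `R90S8ResidueOperatorEquivarianceU3`): for a section `φ`
of the block, `M(z)φ = ψ_z^φ : G(𝔸) → ℂ` is the second constant-term coefficient of its continued Eisenstein family, holomorphic in `z` on the slit half-plane `{1 < Re} ∖ S`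
(`S ⊂ ℝ` finite), and `M₋₁φ = ρψ^φ` is its residue at `z₀` (`(z − z₀)·ψ_z^φ(y) → ρψ^φ(y)` along `𝓝[≠] z₀`).  ★ (b′) `exists_kfinite_scatteringCoords_cm_three` expands
`ψ_z^φ = Σ_j q_j^φ(z)·φ'_j` in finitely many columns on `{2 < Re}`, and K2E2-p12 (g10)'s Euler head factors `q_j^φ = cS·a_j^φ` there with `a_j^φ` HOLOMORPHIC ON `{1 < Re}`
(`cS` = ★ F5's scalar ratio, meromorphic with real poles, `(z − z₀)·cS(z) → ρ`).  Then, with `a` LINEAR in `φ` (rows `ha_add`, `ha_smul`):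
(i) `ψ_z^φ = cS(z)•A(z)φ` with `A(z)φ := Σ_j a_j^φ(z)·φ'_j` on the WHOLE slit domain — both sides are holomorphic there and agree on `{2 < Re}` (★ identity theorem
`R90.S8.eqOn_reSlit_of_eqOn_re_gt`, pointwise in `y`); (ii) every entry `z ↦ A(z)φ(y)` is holomorphic on `{1 < Re}` ∋ `z₀`; (iii) `(z − z₀)·ψ_z^φ(y) = ((z − z₀)·cS(z))·(A(z)φ)(y)
→ ρ·(A(z₀)φ)(y)` (continuity of `a_j^φ` at `z₀`, `S` finite), so by uniqueness of limits **`M₋₁φ = ρ•A(z₀)φ`** — `M₋₁` is LINEAR on the block and, for `ρ ≠ 0`,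
`ker M₋₁ = ker A(z₀)` = `{φ | ∀ j, a_j^φ(z₀) = 0}` when the columns are linearly independent.  Pure finite-dimensional linear algebra + `DifferentiableOn` of finite sums.
* §1 (per vector) **`coeff_eq_cS_smul_sum_on_slit`** (i), **`residue_eq_rho_smul_sum`** (iii), `differentiableOn_sum_entry` (ii).
* §2 (the block) **`exists_operator_factorisation`** — `∃ A : ℂ → V →ₗ[ℂ] (X → ℂ)` with its matrix on `{1 < Re}`, (i) on the slit domain, (ii), (iii).
* §3 corollaries: **`exists_residue_linearMap`** (`M₋₁` is a linear map on the block), **`residue_eq_zero_iff_sum`**, **`residue_eq_zero_iff_coords`** (`ker M₋₁`, `ρ ≠ 0`).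
* §4 the `z₀ := 3∕2` wrappers in ★ p864700's literal `𝓝[≠] ((3 : ℂ) ∕ 2)`: `residue_threeHalves_eq_rho_smul_sum`, `exists_operator_factorisation_threeHalves`
  (`1 < Re(3∕2)` inline by `norm_num`; ★ `K2E1ChiScalarRowsOfRecordU3.one_lt_re_threeHalves` is the named form).
HONEST LABEL: HC_CM is proved only modulo the 7 printed citations (2 remaining named inputs: hLiu418 = `stmt-HodgeConjecture-24832`, h413 = `stmt-HodgeConjecture-24833`) until rung 0
closes; REL ≠ ★ ≠ BUILT; this file asserts no named fact and closes no socket; conditional only on its displayed letters (T's exports `hψhol hρψ`, (b′) `hψq`, K2E2's head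
`hqa ha ha_add ha_smul`, F4∕F5 `hcS hρ`); count-neutral.

## References
* [MoeglinWaldspurger1995] C. Mœglin, J.-L. Waldspurger, *Spectral Decomposition and Eisenstein Series* (1995): IV.1.9–IV.1.11.
* [Langlands1976] R. P. Langlands, *On the Functional Equations Satisfied by Eisenstein Series*, LNM 544 (1976): §7.
* [Conway1978] J. B. Conway, *Functions of One Complex Variable*, 2nd ed., GTM 11 (1978): IV §3 (Thm. 3.7, identity theorem).
-/

set_option autoImplicit false
set_option linter.dupNamespace false -- the mandated namespace repeats `HodgeConjecture.HodgeConjecture`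

noncomputable section

open Set Filter Topology
open Summit.HodgeConjecture.HodgeConjecture.R90.S8 (eqOn_reSlit_of_eqOn_re_gt)

namespace Summit.HodgeConjecture.HodgeConjecture.Cruxes.H413.K2E1ChiScatteringOperatorFactorisationCMThree

/-! ## §1 Per vector: the factorisation on the slit domain, the entries, the residue -/

section PerVector

variable {X : Type*} {ι : Type*} [Fintype ι]

/-- **`z ∉ S` EVENTUALLY ALONG `𝓝[≠] z₀` AND `1 < Re z` THERE** for a finite `S` and `1 < Re z₀`: the punctured neighbourhoods of `z₀` eventually lie in the slit domain `{1 < Re} ∖ S`.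
[folklore] -/
theorem eventually_mem_slit (S : Finset ℂ) {z₀ : ℂ} (hz₀ : 1 < z₀.re) :
    ∀ᶠ z in 𝓝[≠] z₀, z ∈ ({z : ℂ | 1 < z.re} \ (↑S : Set ℂ)) := by
  have h1 : ∀ᶠ z in 𝓝[≠] z₀, 1 < z.re :=
    mem_nhdsWithin_of_mem_nhds ((isOpen_lt continuous_const Complex.continuous_re).mem_nhds hz₀)
  have h2 : ∀ᶠ z in 𝓝[≠] z₀, z ∉ ((↑S : Set ℂ) \ {z₀}) :=
    mem_nhdsWithin_of_mem_nhds (((S.finite_toSet.sdiff).isClosed.isOpen_compl).mem_nhds fun h => h.2 rfl)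
  filter_upwards [h1, h2, self_mem_nhdsWithin] with z hz1 hz2 hz3
  exact ⟨hz1, fun hzS => hz2 ⟨hzS, hz3⟩⟩

/-- **(ii) THE ENTRIES ARE HOLOMORPHIC**: `z ↦ Σ_j a_j(z)·φ'_j(y)` is holomorphic on `{1 < Re}` when every `a_j` is. [cite: Conway1978, IV §3] -/
theorem differentiableOn_sum_entry (φ' : ι → X → ℂ) (a : ι → ℂ → ℂ) (ha : ∀ j, DifferentiableOn ℂ (a j) {z : ℂ | 1 < z.re}) (y : X) :
    DifferentiableOn ℂ (fun z => (∑ j, a j z • φ' j) y) {z : ℂ | 1 < z.re} := by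
  have h : (fun z => (∑ j, a j z • φ' j) y) = fun z => ∑ j, a j z * φ' j y := by
    funext z
    simp only [Finset.sum_apply, Pi.smul_apply, smul_eq_mul]
  rw [h]
  exact DifferentiableOn.fun_sum fun j _ => (ha j).mul_const _

/-- **(i) `M(z)φ = cS(z)•A(z)φ` ON THE WHOLE SLIT DOMAIN.**  If `ψ_z` is holomorphic in `z` on `{1 < Re} ∖ S` pointwise (`hψhol`), expands as `Σ_j q_j(z)·φ'_j` on `{2 < Re}`
(`hψq`, ★ (b′)), `q_j = cS·a_j` there (`hqa`) with `a_j` holomorphic on `{1 < Re}` (`ha`) and `cS` holomorphic on the slit domain (`hcS`), then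
`ψ_z = cS(z)•Σ_j a_j(z)·φ'_j` for EVERY `z ∈ {1 < Re} ∖ S` (★ `eqOn_reSlit_of_eqOn_re_gt` pointwise in `y`). [cite: MoeglinWaldspurger1995, IV.1.9–IV.1.11] [cite: Conway1978, IV §3] -/
theorem coeff_eq_cS_smul_sum_on_slit (S : Finset ℂ) (hS : ∀ t ∈ S, t.im = 0)
    {ψ : ℂ → X → ℂ} (hψhol : ∀ y, DifferentiableOn ℂ (fun z => ψ z y) ({z : ℂ | 1 < z.re} \ (↑S : Set ℂ)))
    {cS : ℂ → ℂ} (hcS : DifferentiableOn ℂ cS ({z : ℂ | 1 < z.re} \ (↑S : Set ℂ)))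
    (φ' : ι → X → ℂ) (q a : ι → ℂ → ℂ)
    (hψq : ∀ z : ℂ, 2 < z.re → ψ z = ∑ j, q j z • φ' j)
    (hqa : ∀ j (z : ℂ), 2 < z.re → q j z = cS z * a j z)
    (ha : ∀ j, DifferentiableOn ℂ (a j) {z : ℂ | 1 < z.re}) :
    ∀ z ∈ ({z : ℂ | 1 < z.re} \ (↑S : Set ℂ)), ψ z = cS z • ∑ j, a j z • φ' j := by
  intro z hz
  funext y
  have hv : DifferentiableOn ℂ (fun z => cS z * (∑ j, a j z • φ' j) y) ({z : ℂ | 1 < z.re} \ (↑S : Set ℂ)) :=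
    hcS.mul ((differentiableOn_sum_entry φ' a ha y).mono sdiff_subset)
  have key := eqOn_reSlit_of_eqOn_re_gt (u := fun z => ψ z y) (v := fun z => cS z * (∑ j, a j z • φ' j) y) (a := 1) (b := 2)
    hS S.finite_toSet.isClosed (hψhol y) hv (fun w hw => by
      simp only [hψq w hw, Finset.sum_apply, Pi.smul_apply, smul_eq_mul, hqa _ w hw, Finset.mul_sum, mul_assoc]) hz
  simpa only [Pi.smul_apply, smul_eq_mul] using key

/-- **(iii) `M₋₁φ = ρ•A(z₀)φ`.**  Under §1's letters, a real pole `z₀` with `1 < Re z₀`, `(z − z₀)·cS(z) → ρ` (`hρ`, ★ F5) and the pole letters `(z − z₀)·ψ_z(y) → ρψ(y)` along `𝓝[≠] z₀`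
(`hρψ`, T's export): `ρψ = ρ•Σ_j a_j(z₀)·φ'_j` — `(z − z₀)·ψ_z(y) = ((z − z₀)·cS z)·(Σ_j a_j(z)·φ'_j(y))` eventually (§1 (i), `S` finite), `a_j` continuous at `z₀`, uniqueness of limits.
[cite: MoeglinWaldspurger1995, IV.1.11] [cite: Langlands1976, §7] -/
theorem residue_eq_rho_smul_sum (S : Finset ℂ) (hS : ∀ t ∈ S, t.im = 0)
    {ψ : ℂ → X → ℂ} (hψhol : ∀ y, DifferentiableOn ℂ (fun z => ψ z y) ({z : ℂ | 1 < z.re} \ (↑S : Set ℂ)))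
    {cS : ℂ → ℂ} (hcS : DifferentiableOn ℂ cS ({z : ℂ | 1 < z.re} \ (↑S : Set ℂ)))
    (φ' : ι → X → ℂ) (q a : ι → ℂ → ℂ)
    (hψq : ∀ z : ℂ, 2 < z.re → ψ z = ∑ j, q j z • φ' j)
    (hqa : ∀ j (z : ℂ), 2 < z.re → q j z = cS z * a j z)
    (ha : ∀ j, DifferentiableOn ℂ (a j) {z : ℂ | 1 < z.re})
    {z₀ : ℂ} (hz₀ : 1 < z₀.re) {ρ : ℂ} (hρ : Tendsto (fun z : ℂ => (z - z₀) * cS z) (𝓝[≠] z₀) (𝓝 ρ))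
    {ρψ : X → ℂ} (hρψ : ∀ y, Tendsto (fun z : ℂ => (z - z₀) * ψ z y) (𝓝[≠] z₀) (𝓝 (ρψ y))) :
    ρψ = ρ • ∑ j, a j z₀ • φ' j := by
  funext y
  -- the entry is continuous at `z₀`
  have hA : Tendsto (fun z => (∑ j, a j z • φ' j) y) (𝓝[≠] z₀) (𝓝 ((∑ j, a j z₀ • φ' j) y)) := by
    have hc : ContinuousAt (fun z => (∑ j, a j z • φ' j) y) z₀ :=
      ((differentiableOn_sum_entry φ' a ha y).differentiableAt ((isOpen_lt continuous_const Complex.continuous_re).mem_nhds hz₀)).continuousAt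
    exact hc.tendsto.mono_left nhdsWithin_le_nhds
  -- `(z − z₀)·ψ_z(y) = ((z − z₀)·cS z)·(A z)(y)` on the punctured neighbourhoods
  have heq : (fun z : ℂ => (z - z₀) * ψ z y) =ᶠ[𝓝[≠] z₀] fun z => (z - z₀) * cS z * (∑ j, a j z • φ' j) y := by
    filter_upwards [eventually_mem_slit S hz₀] with z hz
    rw [coeff_eq_cS_smul_sum_on_slit S hS hψhol hcS φ' q a hψq hqa ha z hz, Pi.smul_apply, smul_eq_mul, mul_assoc]
  have hlim : Tendsto (fun z : ℂ => (z - z₀) * ψ z y) (𝓝[≠] z₀) (𝓝 (ρ * (∑ j, a j z₀ • φ' j) y)) :=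
    (hρ.mul hA).congr' heq.symm
  rw [Pi.smul_apply, smul_eq_mul]
  exact tendsto_nhds_unique (hρψ y) hlim

end PerVector

/-! ## §2 The block: `M(z) = cS(z)•A(z)` with `A(z)` LINEAR, entries holomorphic on `{1 < Re}`, `M₋₁ = ρ•A(z₀)` -/

section Block

variable {V : Type*} [AddCommGroup V] [Module ℂ V] {X : Type*} {ι : Type*} [Fintype ι]

/-- **THE MATRIX `A(z)φ := Σ_j a_j^φ(z)·φ'_j` IS A LINEAR MAP** on `{1 < Re}` when `a` is additive and homogeneous in `φ` there (`ha_add`, `ha_smul`): an `A : ℂ → V →ₗ[ℂ] (X → ℂ)`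
with `A z φ = Σ_j a_j^φ(z)·φ'_j` for `1 < Re z` (and `A z = 0` off the half-plane). [folklore] -/
theorem exists_linearMap_matrix (φ' : ι → X → ℂ) (a : V → ι → ℂ → ℂ)
    (ha_add : ∀ (φ₁ φ₂ : V) (j : ι) (z : ℂ), 1 < z.re → a (φ₁ + φ₂) j z = a φ₁ j z + a φ₂ j z)
    (ha_smul : ∀ (c : ℂ) (φ : V) (j : ι) (z : ℂ), 1 < z.re → a (c • φ) j z = c * a φ j z) :
    ∃ A : ℂ → V →ₗ[ℂ] (X → ℂ), ∀ z : ℂ, 1 < z.re → ∀ φ : V, A z φ = ∑ j, a φ j z • φ' j := by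
  classical
  refine ⟨fun z => if hz : 1 < z.re then
    { toFun := fun φ => ∑ j, a φ j z • φ' j
      map_add' := fun φ₁ φ₂ => by
        simp only [ha_add _ _ _ _ hz, add_smul, Finset.sum_add_distrib]
      map_smul' := fun c φ => by
        simp only [ha_smul _ _ _ _ hz, RingHom.id_apply, Finset.smul_sum, smul_smul] } else 0, fun z hz φ => ?_⟩
  simp only [dif_pos hz, LinearMap.coe_mk, AddHom.coe_mk]

/-- **HEAD — THE OPERATOR FACTORISATION ON A BLOCK.**  Let `V` be a block of sections (any `ℂ`-module), `φ' : ι → X → ℂ` finitely many columns, and for every `φ ∈ V`: the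
continued coefficient `ψ^φ : ℂ → X → ℂ` holomorphic in `z` on `{1 < Re} ∖ S` pointwise (`hψhol`), its (b′) expansion `ψ_z^φ = Σ_j q_j^φ(z)·φ'_j` on `{2 < Re}` (`hψq`), K2E2-p12's
Euler head `q_j^φ = cS·a_j^φ` on `{2 < Re}` with `a_j^φ` holomorphic on `{1 < Re}` (`hqa`, `ha`) and LINEAR in `φ` (`ha_add`, `ha_smul`), `cS` holomorphic on the slit domain with
`(z − z₀)·cS → ρ` (`hcS`, `hρ`), and the pole letters `(z − z₀)·ψ_z^φ(y) → ρψ^φ(y)` (`hρψ`), `z₀` real with `1 < Re z₀`, `S ⊂ ℝ` finite.  THEN there is a linear-operator family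
`A : ℂ → V →ₗ[ℂ] (X → ℂ)` with: its matrix `A z φ = Σ_j a_j^φ(z)·φ'_j` on `{1 < Re}`; **(i)** `ψ_z^φ = cS(z)•A(z)φ` for every `z ∈ {1 < Re} ∖ S` (in particular on `{2 < Re}`);
**(ii)** every entry `z ↦ A(z)φ(y)` holomorphic on `{1 < Re}`; **(iii)** `ρψ^φ = ρ•A(z₀)φ` — the residue operator `M₋₁` is `(Res_{z₀} cS)•A(z₀)`.
[cite: MoeglinWaldspurger1995, IV.1.9–IV.1.11] [cite: Langlands1976, §7] [cite: Conway1978, IV §3] -/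
theorem exists_operator_factorisation (S : Finset ℂ) (hS : ∀ t ∈ S, t.im = 0)
    (ψ : V → ℂ → X → ℂ) (hψhol : ∀ φ y, DifferentiableOn ℂ (fun z => ψ φ z y) ({z : ℂ | 1 < z.re} \ (↑S : Set ℂ)))
    {cS : ℂ → ℂ} (hcS : DifferentiableOn ℂ cS ({z : ℂ | 1 < z.re} \ (↑S : Set ℂ)))
    (φ' : ι → X → ℂ) (q a : V → ι → ℂ → ℂ)
    (hψq : ∀ (φ : V) (z : ℂ), 2 < z.re → ψ φ z = ∑ j, q φ j z • φ' j)
    (hqa : ∀ (φ : V) j (z : ℂ), 2 < z.re → q φ j z = cS z * a φ j z)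
    (ha : ∀ (φ : V) j, DifferentiableOn ℂ (a φ j) {z : ℂ | 1 < z.re})
    (ha_add : ∀ (φ₁ φ₂ : V) (j : ι) (z : ℂ), 1 < z.re → a (φ₁ + φ₂) j z = a φ₁ j z + a φ₂ j z)
    (ha_smul : ∀ (c : ℂ) (φ : V) (j : ι) (z : ℂ), 1 < z.re → a (c • φ) j z = c * a φ j z)
    {z₀ : ℂ} (hz₀ : 1 < z₀.re) {ρ : ℂ} (hρ : Tendsto (fun z : ℂ => (z - z₀) * cS z) (𝓝[≠] z₀) (𝓝 ρ))
    (ρψ : V → X → ℂ) (hρψ : ∀ φ y, Tendsto (fun z : ℂ => (z - z₀) * ψ φ z y) (𝓝[≠] z₀) (𝓝 (ρψ φ y))) :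
    ∃ A : ℂ → V →ₗ[ℂ] (X → ℂ),
      (∀ z : ℂ, 1 < z.re → ∀ φ : V, A z φ = ∑ j, a φ j z • φ' j) ∧
      (∀ φ : V, ∀ z ∈ ({z : ℂ | 1 < z.re} \ (↑S : Set ℂ)), ψ φ z = cS z • A z φ) ∧
      (∀ (φ : V) (y : X), DifferentiableOn ℂ (fun z => A z φ y) {z : ℂ | 1 < z.re}) ∧
      (∀ φ : V, ρψ φ = ρ • A z₀ φ) := by
  obtain ⟨A, hA⟩ := exists_linearMap_matrix φ' a ha_add ha_smul
  refine ⟨A, hA, fun φ z hz => ?_, fun φ y => ?_, fun φ => ?_⟩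
  · rw [hA z hz.1 φ]
    exact coeff_eq_cS_smul_sum_on_slit S hS (hψhol φ) hcS φ' (q φ) (a φ) (hψq φ) (hqa φ) (ha φ) z hz
  · exact (differentiableOn_sum_entry φ' (a φ) (ha φ) y).congr fun z hz => by rw [hA z hz φ]
  · rw [hA z₀ hz₀ φ]
    exact residue_eq_rho_smul_sum S hS (hψhol φ) hcS φ' (q φ) (a φ) (hψq φ) (hqa φ) (ha φ) hz₀ hρ (hρψ φ)

/-! ## §3 Corollaries for line 7 ∕ FACT-N (a): `M₋₁` is linear; `ker M₋₁ = ker A(z₀)` when `ρ ≠ 0` -/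

/-- **`M₋₁` IS A LINEAR MAP ON THE BLOCK**: under the HEAD's letters there is `R : V →ₗ[ℂ] (X → ℂ)` with `R φ = ρψ^φ` for every `φ` (namely `ρ•A(z₀)`).
[cite: MoeglinWaldspurger1995, IV.1.11] -/
theorem exists_residue_linearMap (S : Finset ℂ) (hS : ∀ t ∈ S, t.im = 0)
    (ψ : V → ℂ → X → ℂ) (hψhol : ∀ φ y, DifferentiableOn ℂ (fun z => ψ φ z y) ({z : ℂ | 1 < z.re} \ (↑S : Set ℂ)))
    {cS : ℂ → ℂ} (hcS : DifferentiableOn ℂ cS ({z : ℂ | 1 < z.re} \ (↑S : Set ℂ)))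
    (φ' : ι → X → ℂ) (q a : V → ι → ℂ → ℂ)
    (hψq : ∀ (φ : V) (z : ℂ), 2 < z.re → ψ φ z = ∑ j, q φ j z • φ' j)
    (hqa : ∀ (φ : V) j (z : ℂ), 2 < z.re → q φ j z = cS z * a φ j z)
    (ha : ∀ (φ : V) j, DifferentiableOn ℂ (a φ j) {z : ℂ | 1 < z.re})
    (ha_add : ∀ (φ₁ φ₂ : V) (j : ι) (z : ℂ), 1 < z.re → a (φ₁ + φ₂) j z = a φ₁ j z + a φ₂ j z)
    (ha_smul : ∀ (c : ℂ) (φ : V) (j : ι) (z : ℂ), 1 < z.re → a (c • φ) j z = c * a φ j z)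
    {z₀ : ℂ} (hz₀ : 1 < z₀.re) {ρ : ℂ} (hρ : Tendsto (fun z : ℂ => (z - z₀) * cS z) (𝓝[≠] z₀) (𝓝 ρ))
    (ρψ : V → X → ℂ) (hρψ : ∀ φ y, Tendsto (fun z : ℂ => (z - z₀) * ψ φ z y) (𝓝[≠] z₀) (𝓝 (ρψ φ y))) :
    ∃ R : V →ₗ[ℂ] (X → ℂ), ∀ φ : V, R φ = ρψ φ := by
  obtain ⟨A, -, -, -, hres⟩ := exists_operator_factorisation S hS ψ hψhol hcS φ' q a hψq hqa ha ha_add ha_smul hz₀ hρ ρψ hρψ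
  exact ⟨ρ • A z₀, fun φ => by rw [LinearMap.smul_apply, hres φ]⟩

/-- **`ker M₋₁ = ker A(z₀)` (sum form)**: for `ρ ≠ 0`, `ρψ^φ = 0 ↔ Σ_j a_j^φ(z₀)·φ'_j = 0` (per vector; §1 (iii)). [cite: MoeglinWaldspurger1995, IV.1.11] -/
theorem residue_eq_zero_iff_sum (S : Finset ℂ) (hS : ∀ t ∈ S, t.im = 0)
    {ψ : ℂ → X → ℂ} (hψhol : ∀ y, DifferentiableOn ℂ (fun z => ψ z y) ({z : ℂ | 1 < z.re} \ (↑S : Set ℂ)))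
    {cS : ℂ → ℂ} (hcS : DifferentiableOn ℂ cS ({z : ℂ | 1 < z.re} \ (↑S : Set ℂ)))
    (φ' : ι → X → ℂ) (q a : ι → ℂ → ℂ)
    (hψq : ∀ z : ℂ, 2 < z.re → ψ z = ∑ j, q j z • φ' j)
    (hqa : ∀ j (z : ℂ), 2 < z.re → q j z = cS z * a j z)
    (ha : ∀ j, DifferentiableOn ℂ (a j) {z : ℂ | 1 < z.re})
    {z₀ : ℂ} (hz₀ : 1 < z₀.re) {ρ : ℂ} (hρ : Tendsto (fun z : ℂ => (z - z₀) * cS z) (𝓝[≠] z₀) (𝓝 ρ)) (hρ0 : ρ ≠ 0)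
    {ρψ : X → ℂ} (hρψ : ∀ y, Tendsto (fun z : ℂ => (z - z₀) * ψ z y) (𝓝[≠] z₀) (𝓝 (ρψ y))) :
    ρψ = 0 ↔ (∑ j, a j z₀ • φ' j) = 0 := by
  rw [residue_eq_rho_smul_sum S hS hψhol hcS φ' q a hψq hqa ha hz₀ hρ hρψ, smul_eq_zero]
  exact ⟨fun h => h.resolve_left hρ0, fun h => Or.inr h⟩

/-- **`ker M₋₁` IN COORDINATES**: for `ρ ≠ 0` and LINEARLY INDEPENDENT columns (★ (b′)), `ρψ^φ = 0 ↔ ∀ j, a_j^φ(z₀) = 0`. [cite: MoeglinWaldspurger1995, IV.1.11] -/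
theorem residue_eq_zero_iff_coords (S : Finset ℂ) (hS : ∀ t ∈ S, t.im = 0)
    {ψ : ℂ → X → ℂ} (hψhol : ∀ y, DifferentiableOn ℂ (fun z => ψ z y) ({z : ℂ | 1 < z.re} \ (↑S : Set ℂ)))
    {cS : ℂ → ℂ} (hcS : DifferentiableOn ℂ cS ({z : ℂ | 1 < z.re} \ (↑S : Set ℂ)))
    {φ' : ι → X → ℂ} (hli : LinearIndependent ℂ φ') (q a : ι → ℂ → ℂ)
    (hψq : ∀ z : ℂ, 2 < z.re → ψ z = ∑ j, q j z • φ' j)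
    (hqa : ∀ j (z : ℂ), 2 < z.re → q j z = cS z * a j z)
    (ha : ∀ j, DifferentiableOn ℂ (a j) {z : ℂ | 1 < z.re})
    {z₀ : ℂ} (hz₀ : 1 < z₀.re) {ρ : ℂ} (hρ : Tendsto (fun z : ℂ => (z - z₀) * cS z) (𝓝[≠] z₀) (𝓝 ρ)) (hρ0 : ρ ≠ 0)
    {ρψ : X → ℂ} (hρψ : ∀ y, Tendsto (fun z : ℂ => (z - z₀) * ψ z y) (𝓝[≠] z₀) (𝓝 (ρψ y))) :
    ρψ = 0 ↔ ∀ j, a j z₀ = 0 := by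
  rw [residue_eq_zero_iff_sum S hS hψhol hcS φ' q a hψq hqa ha hz₀ hρ hρ0 hρψ]
  refine ⟨fun h => Fintype.linearIndependent_iff.1 hli (fun j => a j z₀) h, fun h => ?_⟩
  exact Finset.sum_eq_zero fun j _ => by rw [h j, zero_smul]

end Block

/-! ## §4 At the middle pole `z₀ := 3∕2` (★ p864700's literal `𝓝[≠] ((3 : ℂ) ∕ 2)`) -/

section ThreeHalves

variable {V : Type*} [AddCommGroup V] [Module ℂ V] {X : Type*} {ι : Type*} [Fintype ι]

/-- **(iii) AT `3∕2`, per vector**: `ρψ = ρ•Σ_j a_j(3∕2)·φ'_j` in ★ p864700's pole-letter currency. [cite: MoeglinWaldspurger1995, IV.1.11] -/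
theorem residue_threeHalves_eq_rho_smul_sum (S : Finset ℂ) (hS : ∀ t ∈ S, t.im = 0)
    {ψ : ℂ → X → ℂ} (hψhol : ∀ y, DifferentiableOn ℂ (fun z => ψ z y) ({z : ℂ | 1 < z.re} \ (↑S : Set ℂ)))
    {cS : ℂ → ℂ} (hcS : DifferentiableOn ℂ cS ({z : ℂ | 1 < z.re} \ (↑S : Set ℂ)))
    (φ' : ι → X → ℂ) (q a : ι → ℂ → ℂ)
    (hψq : ∀ z : ℂ, 2 < z.re → ψ z = ∑ j, q j z • φ' j)
    (hqa : ∀ j (z : ℂ), 2 < z.re → q j z = cS z * a j z)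
    (ha : ∀ j, DifferentiableOn ℂ (a j) {z : ℂ | 1 < z.re})
    {ρ : ℂ} (hρ : Tendsto (fun z : ℂ => (z - (3 : ℂ) / 2) * cS z) (𝓝[≠] ((3 : ℂ) / 2)) (𝓝 ρ))
    {ρψ : X → ℂ} (hρψ : ∀ y, Tendsto (fun z : ℂ => (z - (3 : ℂ) / 2) * ψ z y) (𝓝[≠] ((3 : ℂ) / 2)) (𝓝 (ρψ y))) :
    ρψ = ρ • ∑ j, a j ((3 : ℂ) / 2) • φ' j :=
  residue_eq_rho_smul_sum S hS hψhol hcS φ' q a hψq hqa ha (by norm_num : (1 : ℝ) < ((3 : ℂ) / 2).re) hρ hρψ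

/-- **HEAD AT `3∕2` — `M(z) = cS(z)•A(z)` on the block and `M₋₁ = (Res_{3∕2} cS)•A(3∕2)`** (§2 HEAD with `z₀ := 3∕2`, ★ p864700's literal pole letters).
[cite: MoeglinWaldspurger1995, IV.1.9–IV.1.11] [cite: Langlands1976, §7] -/
theorem exists_operator_factorisation_threeHalves (S : Finset ℂ) (hS : ∀ t ∈ S, t.im = 0)
    (ψ : V → ℂ → X → ℂ) (hψhol : ∀ φ y, DifferentiableOn ℂ (fun z => ψ φ z y) ({z : ℂ | 1 < z.re} \ (↑S : Set ℂ)))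
    {cS : ℂ → ℂ} (hcS : DifferentiableOn ℂ cS ({z : ℂ | 1 < z.re} \ (↑S : Set ℂ)))
    (φ' : ι → X → ℂ) (q a : V → ι → ℂ → ℂ)
    (hψq : ∀ (φ : V) (z : ℂ), 2 < z.re → ψ φ z = ∑ j, q φ j z • φ' j)
    (hqa : ∀ (φ : V) j (z : ℂ), 2 < z.re → q φ j z = cS z * a φ j z)
    (ha : ∀ (φ : V) j, DifferentiableOn ℂ (a φ j) {z : ℂ | 1 < z.re})
    (ha_add : ∀ (φ₁ φ₂ : V) (j : ι) (z : ℂ), 1 < z.re → a (φ₁ + φ₂) j z = a φ₁ j z + a φ₂ j z)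
    (ha_smul : ∀ (c : ℂ) (φ : V) (j : ι) (z : ℂ), 1 < z.re → a (c • φ) j z = c * a φ j z)
    {ρ : ℂ} (hρ : Tendsto (fun z : ℂ => (z - (3 : ℂ) / 2) * cS z) (𝓝[≠] ((3 : ℂ) / 2)) (𝓝 ρ))
    (ρψ : V → X → ℂ) (hρψ : ∀ φ y, Tendsto (fun z : ℂ => (z - (3 : ℂ) / 2) * ψ φ z y) (𝓝[≠] ((3 : ℂ) / 2)) (𝓝 (ρψ φ y))) :
    ∃ A : ℂ → V →ₗ[ℂ] (X → ℂ),
      (∀ z : ℂ, 1 < z.re → ∀ φ : V, A z φ = ∑ j, a φ j z • φ' j) ∧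
      (∀ φ : V, ∀ z ∈ ({z : ℂ | 1 < z.re} \ (↑S : Set ℂ)), ψ φ z = cS z • A z φ) ∧
      (∀ (φ : V) (y : X), DifferentiableOn ℂ (fun z => A z φ y) {z : ℂ | 1 < z.re}) ∧
      (∀ φ : V, ρψ φ = ρ • A ((3 : ℂ) / 2) φ) :=
  exists_operator_factorisation S hS ψ hψhol hcS φ' q a hψq hqa ha ha_add ha_smul (by norm_num : (1 : ℝ) < ((3 : ℂ) / 2).re) hρ ρψ hρψ

end ThreeHalves

end Summit.HodgeConjecture.HodgeConjecture.Cruxes.H413.K2E1ChiScatteringOperatorFactorisationCMThree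

end
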